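import Literature.Analysis.FluidPDE.NSLocalLerayFarFieldRegularSlabProofs
import Literature.Analysis.FluidPDE.NSBoundedHigherRegularityQuantProofs
import Literature.Analysis.FluidPDE.PineauVicolOneSliceGradient
import Literature.Analysis.FluidPDE.LocalTypeILscPressure
import Literature.Analysis.FluidPDE.SelfSimilar
import Literature.Analysis.FluidPDE.Vorticity
import HarnessLib

/-!
# Crux `RecurrentLiouville` (stmt-NavierStokesRegularity-1589), line `Sketch` — stub `stub_satFarFieldRegularity` (D1)

Theorems-only file (no definitions, no named facts).

`stub_satFarFieldRegularity` — FAR-FIELD REGULARITY OF APEX-CLASS PROFILES UP TO THE FINAL TIME.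
Let `(u, p)` be a suitable weak solution of Navier–Stokes (`ν = 1`, `f = 0`) on the backward slab
`ℝ₋ × ℝ³` with a weak gradient `G`, finite Albritton–Barker quantity `𝐈(ℝ₋ × ℝ³) < ∞`
(Albritton–Barker 2019, §1: the supremum over all backward parabolic balls of `A + C + D + E`,
with the MEAN-FREE pressure quantity `D(Q(z, r)) = r⁻² ∫∫_{Q(z,r)} |p - [p]_{B(x,r)}|^{3/2}`), and
the apex bound `‖u(t, x)‖ ≤ C/(‖x‖ + √(−t))` (KNSS 2009, (1.6)).  Then for every `R₀` there are
`R ≥ R₀`, `M₀` and a representative `U` of `u` on `Ω = (-1, 0) × {‖x‖ > R}` which is jointly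
continuous with `C³` slices, `‖U‖, ‖∇U‖ ≤ M₀`, whose vorticity `ω = ∇ ∧ U` is jointly `C¹` with
`‖ω‖, ‖∇ω‖, ‖∇²ω‖, ‖∂ₜω‖ ≤ M₀`, and which solves the vorticity equation
`∂ₜω = Δω - (U·∇)ω + (ω·∇)U` pointwise on `Ω` — the format of the tree fact
`localLeray_exterior_vorticity_regular_of_bounded_slab`.  This is Step 2 of the dark-profiles
argument (Escauriaza–Seregin–Šverák 2003, §3; Lemarié-Rieusset 2016, proof of Thm. 15.4, Step 2):
the apex bound makes `u` bounded by `C` on `{‖x‖ > 1}` UP TO `t = 0`.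

Proof route over the tree (adapted from `exists_farField_representative_unit` and
`localLeray_exterior_vorticity_regular_of_bounded_slab_of_facts`,
`NSLocalLerayFarFieldRegularSlabProofs.lean`, where the class was the local Leray class):

* `satFR_gauge_solution`, `satFR_gauge_bound` — on a backward cylinder `Q(z, r) ⊆ ℝ₋ × ℝ³` the
  pressure gauged by its ball mean, `p - [p]_{B(z.2, r)}(t)`, is again a distributional pressure
  (`IsDistributionalNSSolutionOn.sub_timeFun`; the gauge is locally integrable on the cylinder by
  Fubini, `memLp_setAverage_slice`), and `∫∫_{Q(z,r)} |p - [p]|^{3/2} = r² D(Q(z,r)) ≤ r² 𝐈` —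
  a bound UNIFORM in the centre (this replaces the Kang–Miura–Tsai pressure bound of the local
  Leray version);
* `satFR_representative` — cover `Ω` by the cylinders `Q((t', x), 2ρ)`, `t' = min(t + ρ², 0)`
  (`parabolicCylinder_top_subset_farField`: they lie in `(-2, 0) × {‖x‖ > R₁}`, `R₁ ≥ 1`, hence
  `|u| ≤ C` there by the apex bound), apply Seregin–Šverák's quantitative higher regularity
  `NSBoundedHigherRegularityBounds_holds` (§2 p. 8) with the common data `(2ρ, C, (2ρ)² 𝐈)`, and
  glue the local smooth representatives (`exists_continuousOn_ae_eq_of_locally`,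
  `Measure.eqOn_open_of_ae_eq`);
* the assembly — `vorticity_classical_of_isDistributionalNSSolutionOn` (the classical vorticity
  equation and the joint `C¹` regularity of `ω` for a representative with jointly continuous
  `D_xⁿU`, `n ≤ 3`) and `vorticity_pointwise_bounds` (`M₀ = K + 3κK + 3κK + 2κK²`, `κ = ‖curl‖`).

## References

* G. Seregin, V. Šverák, Comm. PDE 34 (2009) = arXiv:0804.1803, §2 p. 8. [SereginSverak2009]
* P. G. Lemarié-Rieusset, *The Navier–Stokes Problem in the 21st Century* (2016),
  doi:10.1201/b19556, proof of Thm. 15.4, Step 2. [LemarieRieusset2016]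
* D. Albritton, T. Barker, J. Math. Fluid Mech. 21 (2019) = arXiv:1811.00502, §1.
  [AlbrittonBarker2019]
* L. Escauriaza, G. Seregin, V. Šverák, Russian Math. Surveys 58 (2003) 211–250, §3.
  [EscauriazaSereginSverak2003]
-/

noncomputable section

-- the sub-problem namespace repeats the summit name (D-0017 layout `Summit.<S>.<P>.Theorems`)
set_option linter.dupNamespace false

namespace Summit.NavierStokesRegularity.NavierStokesRegularity.Theorems

open MeasureTheory Set Function Filter Topology TopologicalSpace Metric
open Literature.Analysis.FluidPDE
open scoped NNReal ENNReal RealInnerProductSpace Laplacian ContDiff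

/-! ### The pressure gauge on backward cylinders inside the slab -/

/-- **Gauging the pressure by its ball mean keeps a distributional solution** on a backward
cylinder `Q(z, r) ⊆ ℝ₋ × ℝ³`: `(u, p - [p]_{B(z.2, r)}(t))` solves Navier–Stokes in `𝒟'(Q(z, r))`
(`IsDistributionalNSSolutionOn.sub_timeFun`).  The gauge `(t, y) ↦ [p]_{B}(t)` is locally
integrable on the open cylinder: a compact `k ⊆ Q(z, r)` projects to a compact set of times `I`,
`I × B̄(z.2, r)` is a compact subset of the open slab, so `p ∈ L¹` there, and the slice average of
an `L¹` function of the box is `L¹` (`memLp_setAverage_slice`). [cite: AlbrittonBarker2019, §1] -/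
theorem satFR_gauge_solution
    {u : ℝ → EuclideanSpace ℝ (Fin 3) → EuclideanSpace ℝ (Fin 3)}
    {p : ℝ → EuclideanSpace ℝ (Fin 3) → ℝ}
    (hsw : IsSuitableWeakSolutionOn (slab (EuclideanSpace ℝ (Fin 3)) (Iio 0) isOpen_Iio) 1 0 u p)
    {r : ℝ} (hr : 0 < r) {z : ℝ × EuclideanSpace ℝ (Fin 3)}
    (hQ : parabolicCylinder r z ⊆ Iio (0 : ℝ) ×ˢ (univ : Set (EuclideanSpace ℝ (Fin 3)))) :
    IsDistributionalNSSolutionOn (parabolicCylinderOpens r z) 1 0 u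
      (fun s y => p s y - ⨍ y' in ball z.2 r, p s y') := by
  have hle : parabolicCylinderOpens r z ≤ slab (EuclideanSpace ℝ (Fin 3)) (Iio 0) isOpen_Iio :=
    fun w hw => mem_slab.2 (hQ hw).1
  refine (hsw.distributional.of_le hle).sub_timeFun ?_
  rw [coe_parabolicCylinderOpens,
    locallyIntegrableOn_iff (isOpen_parabolicCylinder r z).isLocallyClosed]
  intro k hk hkc
  -- the compact set of times of `k` and the box `I × B(z.2, r) ⊇ k`
  set I : Set ℝ := Prod.fst '' k with hI
  have hIc : IsCompact I := hkc.image continuous_fst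
  have hkI : k ⊆ I ×ˢ ball z.2 r := fun w hw => ⟨mem_image_of_mem _ hw, (mem_parabolicCylinder.1 (hk hw)).2⟩
  have hIslab : I ×ˢ closedBall z.2 r ⊆
      ((slab (EuclideanSpace ℝ (Fin 3)) (Iio 0) isOpen_Iio : Opens (ℝ × EuclideanSpace ℝ (Fin 3))) :
        Set (ℝ × EuclideanSpace ℝ (Fin 3))) := by
    rintro w ⟨⟨w', hw', hw'1⟩, -⟩
    rw [coe_slab]
    refine ⟨?_, mem_univ _⟩
    rw [← hw'1]
    exact (hQ (hk hw')).1
  -- `p ∈ L¹(I × B)` and so is its slice average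
  have hpI : IntegrableOn (uncurry p) (I ×ˢ ball z.2 r) volume :=
    (hsw.distributional.2.2.1.integrableOn_compact_subset hIslab
      (hIc.prod (isCompact_closedBall _ _))).mono_set (prod_mono Subset.rfl ball_subset_closedBall)
  have h1 : MemLp (uncurry p) 1 (volume.restrict (I ×ˢ ball z.2 r)) :=
    memLp_one_iff_integrable.2 hpI
  have h2 := memLp_setAverage_slice (measure_ball_pos volume z.2 hr).ne' measure_ball_lt_top.ne
    le_rfl ENNReal.one_ne_top h1
  exact IntegrableOn.mono_set (memLp_one_iff_integrable.1 h2) hkI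

/-- **The gauged pressure is controlled by `𝐈`, uniformly in the centre**: for a backward
cylinder `Q(z, r) ⊆ ℝ₋ × ℝ³`, `∫∫_{Q(z,r)} |p - [p]_{B(z.2,r)}|^{3/2} = r² D(Q(z, r)) ≤ r² 𝐈(ℝ₋ × ℝ³)`
(`D ≤ A + C + D + E ≤ 𝐈`, `abScaledSum_le_typeIBound`). [cite: AlbrittonBarker2019, §1] -/
theorem satFR_gauge_bound
    {u : ℝ → EuclideanSpace ℝ (Fin 3) → EuclideanSpace ℝ (Fin 3)}
    {p : ℝ → EuclideanSpace ℝ (Fin 3) → ℝ}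
    (G : ℝ → EuclideanSpace ℝ (Fin 3) → EuclideanSpace ℝ (Fin 3) →L[ℝ] EuclideanSpace ℝ (Fin 3))
    {r : ℝ} (hr : 0 < r) {z : ℝ × EuclideanSpace ℝ (Fin 3)}
    (hQ : parabolicCylinder r z ⊆ Iio (0 : ℝ) ×ˢ (univ : Set (EuclideanSpace ℝ (Fin 3)))) :
    ∫⁻ w in parabolicCylinder r z, ‖p w.1 w.2 - ⨍ y' in ball z.2 r, p w.1 y'‖ₑ ^ (3 / 2 : ℝ) ≤
      ENNReal.ofReal r ^ 2 * typeIBound (Iio (0 : ℝ) ×ˢ univ) u p G := by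
  have h0 : ENNReal.ofReal r ^ 2 ≠ 0 := pow_ne_zero _ (ENNReal.ofReal_pos.2 hr).ne'
  have htop : ENNReal.ofReal r ^ 2 ≠ ⊤ := ENNReal.pow_ne_top ENNReal.ofReal_ne_top
  have e : ∫⁻ w in parabolicCylinder r z, ‖p w.1 w.2 - ⨍ y' in ball z.2 r, p w.1 y'‖ₑ ^ (3 / 2 : ℝ) =
      ENNReal.ofReal r ^ 2 * cknDOsc r z p := by
    rw [cknDOsc, ← mul_assoc, ENNReal.mul_inv_cancel h0 htop, one_mul]
  rw [e]
  gcongr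
  calc cknDOsc r z p ≤ cknAEss r z u + cknC r z u + cknDOsc r z p := le_add_self
    _ ≤ abScaledSum r z u p G := le_self_add
    _ ≤ typeIBound (Iio (0 : ℝ) ×ˢ univ) u p G := abScaledSum_le_typeIBound hr hQ

/-! ### The far-field smooth representative with uniform derivative bounds -/

/-- **Far-field smooth representative of an apex-class profile, up to the final time, with
uniform bounds on `D_xⁿU`, `n ≤ 3`** (Lemarié-Rieusset 2016, proof of Thm. 15.4, Step 2, for the
Type-I ancient class; Seregin–Šverák 2009, §2 p. 8).  If `(u, p)` is a suitable weak solution on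
`ℝ₋ × ℝ³` with `𝐈(ℝ₋ × ℝ³) < ∞` and the apex bound with constant `C ≥ 0`, then for `1 ≤ R₁ < R`
`u` has a representative `U` on `Ω = (-1, 0) × {‖x‖ > R}` which is jointly continuous, has `C^∞`
slices at the points of `Ω`, jointly continuous spatial derivatives, and `‖D_xⁿU‖ ≤ K` on `Ω`
for `n ≤ 3`.  Proof: cover `Ω` by the backward cylinders `Q((t', x), 2ρ)`, `t' = min(t + ρ², 0)`,
`4ρ² ≤ 1`, `2ρ ≤ R - R₁`, which lie in `(-2, 0) × {‖y‖ > R₁}` where `|u| ≤ C/(‖y‖ + √(−t)) ≤ C`;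
gauge the pressure by its ball mean (`satFR_gauge_solution`, `satFR_gauge_bound`: the data
`(2ρ, C, (2ρ)² 𝐈)` of `NSBoundedHigherRegularityBounds_holds` do not depend on the centre), so
the local smooth representatives obey one bound on the inner cylinders `Q((t', x), 3ρ/2) ∋ (t, x)`;
glue them along `Ω`. [cite: LemarieRieusset2016, proof of Thm. 15.4, Step 2; SereginSverak2009, §2 p. 8] -/
theorem satFR_representative
    {u : ℝ → EuclideanSpace ℝ (Fin 3) → EuclideanSpace ℝ (Fin 3)}
    {p : ℝ → EuclideanSpace ℝ (Fin 3) → ℝ}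
    {G : ℝ → EuclideanSpace ℝ (Fin 3) → EuclideanSpace ℝ (Fin 3) →L[ℝ] EuclideanSpace ℝ (Fin 3)} {C : ℝ}
    (hsw : IsSuitableWeakSolutionOn (slab (EuclideanSpace ℝ (Fin 3)) (Iio 0) isOpen_Iio) 1 0 u p)
    (hI : typeIBound (Iio (0 : ℝ) ×ˢ univ) u p G < ⊤) (hdec : HasTypeIDecay C u) (hC0 : 0 ≤ C)
    {R₁ R : ℝ} (hR₁ : 1 ≤ R₁) (hR : R₁ < R) :
    ∃ (K : ℝ) (U : ℝ → EuclideanSpace ℝ (Fin 3) → EuclideanSpace ℝ (Fin 3)),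
      uncurry U =ᵐ[volume.restrict
        (Ioo (-1 : ℝ) 0 ×ˢ (closedBall (0 : EuclideanSpace ℝ (Fin 3)) R)ᶜ)] uncurry u ∧
      ContinuousOn (uncurry U) (Ioo (-1 : ℝ) 0 ×ˢ (closedBall (0 : EuclideanSpace ℝ (Fin 3)) R)ᶜ) ∧
      (∀ w ∈ Ioo (-1 : ℝ) 0 ×ˢ (closedBall (0 : EuclideanSpace ℝ (Fin 3)) R)ᶜ,
        ContDiffAt ℝ (⊤ : ℕ∞) (U w.1) w.2) ∧
      (∀ n : ℕ, ContinuousOn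
        (fun w : ℝ × EuclideanSpace ℝ (Fin 3) => iteratedFDeriv ℝ n (U w.1) w.2)
        (Ioo (-1 : ℝ) 0 ×ˢ (closedBall (0 : EuclideanSpace ℝ (Fin 3)) R)ᶜ)) ∧
      ∀ n ≤ 3, ∀ w ∈ Ioo (-1 : ℝ) 0 ×ˢ (closedBall (0 : EuclideanSpace ℝ (Fin 3)) R)ᶜ,
        ‖iteratedFDeriv ℝ n (U w.1) w.2‖ ≤ K := by
  -- adapted from `exists_farField_representative_unit` (NSLocalLerayFarFieldRegularSlabProofs.lean)
  set Ω : Set (ℝ × EuclideanSpace ℝ (Fin 3)) :=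
    Ioo (-1 : ℝ) 0 ×ˢ (closedBall (0 : EuclideanSpace ℝ (Fin 3)) R)ᶜ with hΩ
  have hΩo : IsOpen Ω := isOpen_Ioo.prod isClosed_closedBall.isOpen_compl
  -- the radius `ρ`: `4ρ² ≤ 1 = (-1) - (-2)`, `2ρ ≤ R - R₁`
  set ρ : ℝ := min (1 / 2) ((R - R₁) / 2) with hρdef
  have hρ : 0 < ρ := lt_min (by norm_num) (by linarith)
  have hρ1 : ρ ≤ 1 / 2 := min_le_left _ _
  have hρt : 4 * ρ ^ 2 ≤ (-1 : ℝ) - (-2) := by nlinarith [mul_le_mul_of_nonneg_left hρ1 hρ.le]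
  have hρR : 2 * ρ ≤ R - R₁ := by have := min_le_right (1 / 2 : ℝ) ((R - R₁) / 2); linarith
  have h2ρ : 0 < 2 * ρ := by positivity
  have hr : (3 / 2 * ρ) ∈ Ioo 0 (2 * ρ) := ⟨by positivity, by linarith⟩
  -- the uniform pressure level `P = (2ρ)² 𝐈`
  set P : ℝ≥0 := (ENNReal.ofReal (2 * ρ) ^ 2 * typeIBound (Iio (0 : ℝ) ×ˢ univ) u p G).toNNReal
    with hPdef
  have hP : (P : ℝ≥0∞) = ENNReal.ofReal (2 * ρ) ^ 2 * typeIBound (Iio (0 : ℝ) ×ˢ univ) u p G :=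
    ENNReal.coe_toNNReal (ENNReal.mul_ne_top (ENNReal.pow_ne_top ENNReal.ofReal_ne_top) hI.ne)
  -- the uniform constant of the interior regularity fact, data `(2ρ, C, P)`
  obtain ⟨K₀, hK₀⟩ := NSBoundedHigherRegularityBounds_holds.exists_uniform_bound (2 * ρ) C P hr 3
  -- Step 1: local smooth representatives with the uniform bound
  have hloc : ∀ w ∈ Ω, ∃ Tw : Set (ℝ × EuclideanSpace ℝ (Fin 3)), IsOpen Tw ∧ w ∈ Tw ∧ Tw ⊆ Ω ∧
      ∃ V : ℝ → EuclideanSpace ℝ (Fin 3) → EuclideanSpace ℝ (Fin 3),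
      uncurry u =ᵐ[volume.restrict Tw] uncurry V ∧ ContinuousOn (uncurry V) Tw ∧
      (∀ w' ∈ Tw, ContDiffAt ℝ (⊤ : ℕ∞) (V w'.1) w'.2) ∧
      (∀ n : ℕ, ContinuousOn
        (fun w' : ℝ × EuclideanSpace ℝ (Fin 3) => iteratedFDeriv ℝ n (V w'.1) w'.2) Tw) ∧
      ∀ n ≤ 3, ∀ w' ∈ Tw, ‖iteratedFDeriv ℝ n (V w'.1) w'.2‖ ≤ K₀ := by
    rintro ⟨t, x⟩ ⟨ht, hx⟩
    set z : ℝ × EuclideanSpace ℝ (Fin 3) := (min (t + ρ ^ 2) 0, x) with hz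
    have hQ₀ : parabolicCylinder (2 * ρ) z ⊆
        Ioo (-2 : ℝ) 0 ×ˢ (closedBall (0 : EuclideanSpace ℝ (Fin 3)) R₁)ᶜ :=
      parabolicCylinder_top_subset_farField hρt hρR ht hx
    have hQneg : parabolicCylinder (2 * ρ) z ⊆ Iio (0 : ℝ) ×ˢ (univ : Set (EuclideanSpace ℝ (Fin 3))) :=
      fun w hw => ⟨(hQ₀ hw).1.2, mem_univ _⟩
    -- the gauged pressure on the cylinder
    have hsol := satFR_gauge_solution hsw h2ρ hQneg
    have hbdQ : ∀ᵐ w ∂(volume.restrict (parabolicCylinder (2 * ρ) z)), ‖u w.1 w.2‖ ≤ C := by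
      refine (ae_restrict_iff' (isOpen_parabolicCylinder _ _).measurableSet).2 (ae_of_all _ ?_)
      intro w hw
      have hw1 : w.1 < 0 := (hQ₀ hw).1.2
      have hw2 : R₁ < ‖w.2‖ := by
        have h := (hQ₀ hw).2
        rwa [mem_compl_iff, mem_closedBall, dist_zero_right, not_le] at h
      calc ‖u w.1 w.2‖ ≤ C / (‖w.2‖ + Real.sqrt (-w.1)) := hdec w.1 hw1 w.2
        _ ≤ C := div_le_self hC0 (by nlinarith [Real.sqrt_nonneg (-w.1)])
    have hpQ : ∫⁻ w in parabolicCylinder (2 * ρ) z,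
        ‖p w.1 w.2 - ⨍ y' in ball z.2 (2 * ρ), p w.1 y'‖ₑ ^ (3 / 2 : ℝ) ≤ P :=
      (satFR_gauge_bound G h2ρ hQneg).trans_eq hP.symm
    obtain ⟨V, hae, hVc, hCD, hHol, hbdV⟩ := hK₀ u _ z hsol hbdQ hpQ
    -- the neighbourhood `Tw = Q(z, 3ρ/2) ∩ Ω`
    have hsub : parabolicCylinder (3 / 2 * ρ) z ⊆ parabolicCylinder (2 * ρ) z := by
      intro w hw
      rw [mem_parabolicCylinder] at hw ⊢
      exact ⟨⟨by nlinarith [hw.1.1], hw.1.2⟩, hw.2.trans (by linarith)⟩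
    refine ⟨parabolicCylinder (3 / 2 * ρ) z ∩ Ω, (isOpen_parabolicCylinder _ _).inter hΩo,
      ⟨mem_parabolicCylinder_top hρ ht.2, ht, hx⟩, inter_subset_right, V,
      ae_restrict_of_ae_restrict_of_subset (inter_subset_left.trans hsub) hae,
      hVc.mono (inter_subset_left.trans hsub), fun w' hw' => hCD w' (hsub hw'.1),
      fun n => ?_, fun n hn w' hw' => hbdV n hn w' hw'.1⟩
    obtain ⟨C', α, hα, hH⟩ := hHol n (3 / 2 * ρ) hr
    exact (hH.continuousOn hα).mono inter_subset_left
  -- Step 2: glue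
  have hloc' : ∀ w ∈ Ω, ∃ Tw : Set (ℝ × EuclideanSpace ℝ (Fin 3)), IsOpen Tw ∧ w ∈ Tw ∧ Tw ⊆ Ω ∧
      ∃ g : ℝ × EuclideanSpace ℝ (Fin 3) → EuclideanSpace ℝ (Fin 3),
        ContinuousOn g Tw ∧ uncurry u =ᵐ[volume.restrict Tw] g := by
    intro w hw
    obtain ⟨Tw, hTo, hwT, hTΩ, V, hae, hVc, -⟩ := hloc w hw
    exact ⟨Tw, hTo, hwT, hTΩ, uncurry V, hVc, hae⟩
  obtain ⟨g, hg, hug⟩ := exists_continuousOn_ae_eq_of_locally (μ := volume) hloc'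
  -- Step 3: the glued field agrees with the local representatives on their neighbourhoods
  have hagree : ∀ {Tw : Set (ℝ × EuclideanSpace ℝ (Fin 3))}
      {V : ℝ → EuclideanSpace ℝ (Fin 3) → EuclideanSpace ℝ (Fin 3)}, IsOpen Tw → Tw ⊆ Ω →
      uncurry u =ᵐ[volume.restrict Tw] uncurry V → ContinuousOn (uncurry V) Tw →
      EqOn (uncurry (curry g)) (uncurry V) Tw := by
    intro Tw V hTo hTΩ hae hVc
    have h1 : uncurry (curry g) =ᵐ[volume.restrict Tw] uncurry V := by
      have h3 : uncurry u =ᵐ[volume.restrict Tw] g := ae_restrict_of_ae_restrict_of_subset hTΩ hug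
      simpa using h3.symm.trans hae
    refine Measure.eqOn_open_of_ae_eq h1 hTo ?_ hVc
    simpa using hg.mono hTΩ
  refine ⟨K₀, curry g, ?_, ?_, fun w hw => ?_, fun n w hw => ?_, fun n hn w hw => ?_⟩
  · simpa using hug.symm
  · simpa using hg
  · obtain ⟨Tw, hTo, hwT, hTΩ, V, hae, hVc, hCD, -⟩ := hloc w hw
    exact contDiffAt_of_eqOn hTo (hagree hTo hTΩ hae hVc) hwT (hCD w hwT)
  · obtain ⟨Tw, hTo, hwT, hTΩ, V, hae, hVc, -, hjc, -⟩ := hloc w hw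
    have heq := hagree hTo hTΩ hae hVc
    have h1 : ContinuousOn
        (fun w' : ℝ × EuclideanSpace ℝ (Fin 3) => iteratedFDeriv ℝ n (curry g w'.1) w'.2) Tw :=
      (hjc n).congr fun w' hw' => iteratedFDeriv_slice_eq_of_eqOn hTo heq n hw'
    exact (h1.continuousAt (hTo.mem_nhds hwT)).continuousWithinAt
  · obtain ⟨Tw, hTo, hwT, hTΩ, V, hae, hVc, -, -, hbdV⟩ := hloc w hw
    rw [iteratedFDeriv_slice_eq_of_eqOn hTo (hagree hTo hTΩ hae hVc) n hwT]
    exact hbdV n hn w hwT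

/-! ### D1 — far-field regularity of apex-class profiles up to the final time -/

/-- `‖Df(x)‖ = ‖D¹f(x)‖` (Mathlib's `iteratedFDeriv` of order one; private copy of the tree's
`norm_fderiv_eq_norm_iteratedFDeriv_one`). [folklore] -/
private theorem satFR_norm_fderiv_eq_norm_iteratedFDeriv_one {F : Type*} [NormedAddCommGroup F]
    [NormedSpace ℝ F] (f : EuclideanSpace ℝ (Fin 3) → F) (x : EuclideanSpace ℝ (Fin 3)) :
    ‖fderiv ℝ f x‖ = ‖iteratedFDeriv ℝ 1 f x‖ := by
  rw [← norm_iteratedFDeriv_fderiv (n := 0), norm_iteratedFDeriv_zero]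

/-- **D1, far-field regularity package.**  A member of the class with the apex bound has, for
every `R₀`, a radius `R ≥ R₀`, a constant `M₀` and a representative `U` on the far-field region
`Ω = (-1, 0) × {‖x‖ > R}` such that: `U = u` a.e. on `Ω`; `U` is jointly continuous on `Ω` with
`C³` slices and `‖U‖, ‖∇U‖ ≤ M₀`; the vorticity `ω = ∇ ∧ U` is jointly `C¹` on `Ω` with
`‖ω‖, ‖∇ω‖, ‖∇²ω‖, ‖∂ₜω‖ ≤ M₀`; and the vorticity equation holds pointwise on `Ω` (`ν = 1`).
(The apex bound makes `u` bounded by `C/R` on `{‖x‖ > R}` up to `t = 0`; Seregin–Šverák's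
quantitative higher regularity `NSBoundedHigherRegularityBounds_holds` on unit backward
cylinders with the pressure made mean-free, and the classical structure of the continuous
Oseen-mild representative on `t < 0`.)  Same format as the tree fact
`localLeray_farField_vorticity_regular_slab`.  Registered stub.  Proof: `satFR_representative`
(`R = max R₀ 1 + 2`), then `vorticity_classical_of_isDistributionalNSSolutionOn` for the
distributional solution `(U, p)` on `Ω` and `vorticity_pointwise_bounds` with
`M₀ = K + 3κK + 3κK + 2κK²`, `κ = ‖curlCLM‖`.
[cite: LemarieRieusset2016, proof of Thm. 15.4, Step 2; EscauriazaSereginSverak2003, §3; SereginSverak2009, §2 p. 8] -/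
theorem stub_satFarFieldRegularity :
    ∀ (u : ℝ → EuclideanSpace ℝ (Fin 3) → EuclideanSpace ℝ (Fin 3))
      (p : ℝ → EuclideanSpace ℝ (Fin 3) → ℝ)
      (G : ℝ → EuclideanSpace ℝ (Fin 3) → EuclideanSpace ℝ (Fin 3) →L[ℝ] EuclideanSpace ℝ (Fin 3)) (C : ℝ),
      IsSuitableWeakSolutionOn (slab (EuclideanSpace ℝ (Fin 3)) (Iio 0) isOpen_Iio) 1 0 u p →
      HasWeakSpatialGradientOn (slab (EuclideanSpace ℝ (Fin 3)) (Iio 0) isOpen_Iio) u G →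
      typeIBound (Iio (0 : ℝ) ×ˢ univ) u p G < ⊤ → HasTypeIDecay C u →
      ∀ R₀ : ℝ, ∃ (R M₀ : ℝ) (U : ℝ → EuclideanSpace ℝ (Fin 3) → EuclideanSpace ℝ (Fin 3)), R₀ ≤ R ∧
        uncurry U =ᵐ[volume.restrict
          (Ioo (-1 : ℝ) 0 ×ˢ (closedBall (0 : EuclideanSpace ℝ (Fin 3)) R)ᶜ)] uncurry u ∧
        ContinuousOn (uncurry U) (Ioo (-1 : ℝ) 0 ×ˢ (closedBall (0 : EuclideanSpace ℝ (Fin 3)) R)ᶜ) ∧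
        (∀ t ∈ Ioo (-1 : ℝ) 0, ContDiffOn ℝ 3 (U t) (closedBall (0 : EuclideanSpace ℝ (Fin 3)) R)ᶜ) ∧
        (∀ t ∈ Ioo (-1 : ℝ) 0, ∀ x ∈ (closedBall (0 : EuclideanSpace ℝ (Fin 3)) R)ᶜ,
          ‖U t x‖ ≤ M₀ ∧ ‖fderiv ℝ (U t) x‖ ≤ M₀) ∧
        ContDiffOn ℝ 1 (uncurry (vorticity U))
          (Ioo (-1 : ℝ) 0 ×ˢ (closedBall (0 : EuclideanSpace ℝ (Fin 3)) R)ᶜ) ∧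
        (∀ t ∈ Ioo (-1 : ℝ) 0, ∀ x ∈ (closedBall (0 : EuclideanSpace ℝ (Fin 3)) R)ᶜ,
          ‖vorticity U t x‖ ≤ M₀ ∧ ‖fderiv ℝ (vorticity U t) x‖ ≤ M₀ ∧
          ‖iteratedFDeriv ℝ 2 (vorticity U t) x‖ ≤ M₀ ∧ ‖timeDeriv (vorticity U) t x‖ ≤ M₀) ∧
        ∀ t ∈ Ioo (-1 : ℝ) 0, ∀ x ∈ (closedBall (0 : EuclideanSpace ℝ (Fin 3)) R)ᶜ,
          timeDeriv (vorticity U) t x = (1 : ℝ) • (Δ (vorticity U t)) x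
            - convect (U t) (vorticity U t) x + convect (vorticity U t) (U t) x := by
  -- adapted from `localLeray_exterior_vorticity_regular_of_bounded_slab_of_facts`
  intro u p G C hsw _hGw hI hdec R₀
  have hC0 : 0 ≤ C := by
    have h := hdec (-1) (by norm_num) 0
    rw [norm_zero, zero_add, neg_neg, Real.sqrt_one, div_one] at h
    exact (norm_nonneg _).trans h
  set R : ℝ := max R₀ 1 + 2 with hRdef
  have hR₀R : R₀ ≤ R := by have := le_max_left R₀ 1; linarith
  have hS : IsOpen ((closedBall (0 : EuclideanSpace ℝ (Fin 3)) R)ᶜ) := isClosed_closedBall.isOpen_compl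
  obtain ⟨K, U, hae, hUc, hCD, hjc, hbdK⟩ :=
    satFR_representative hsw hI hdec hC0 (le_max_right R₀ 1) (R := R) (by linarith)
  -- `(U, p)` is a distributional solution on `Ω = (-1, 0) × {‖x‖ > R}`
  have hle : (⟨Ioo (-1 : ℝ) 0 ×ˢ (closedBall (0 : EuclideanSpace ℝ (Fin 3)) R)ᶜ, isOpen_Ioo.prod hS⟩ :
      Opens (ℝ × EuclideanSpace ℝ (Fin 3))) ≤ slab (EuclideanSpace ℝ (Fin 3)) (Iio 0) isOpen_Iio :=
    fun w hw => mem_slab.2 hw.1.2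
  have hsolU : IsDistributionalNSSolutionOn
      ⟨Ioo (-1 : ℝ) 0 ×ˢ (closedBall (0 : EuclideanSpace ℝ (Fin 3)) R)ᶜ, isOpen_Ioo.prod hS⟩ 1 0 U p :=
    (hsw.distributional.of_le hle).congr_ae hae.symm (ae_of_all _ fun _ => rfl)
  -- the slices are `C³` on the exterior region
  have hU3 : ∀ t ∈ Ioo (-1 : ℝ) 0, ContDiffOn ℝ 3 (U t) (closedBall (0 : EuclideanSpace ℝ (Fin 3)) R)ᶜ :=
    fun t ht x hx => ((hCD (t, x) ⟨ht, hx⟩).of_le (by norm_cast)).contDiffWithinAt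
  -- the classical vorticity equation and the joint `C¹` regularity
  obtain ⟨-, -, -, hEq, hC1⟩ := vorticity_classical_of_isDistributionalNSSolutionOn isOpen_Ioo hS
    hsolU hU3 fun n _ => hjc n
  -- the constants
  set K' : ℝ := max K 0 with hK'
  have hK'0 : 0 ≤ K' := le_max_right _ _
  have hKK' : K ≤ K' := le_max_left _ _
  set κ : ℝ := ‖curlCLM‖ with hκ
  have hκ0 : 0 ≤ κ := ContinuousLinearMap.opNorm_nonneg _
  set M₀ : ℝ := K' + 3 * κ * K' + 3 * 1 * κ * K' + 2 * κ * K' ^ 2 with hM₀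
  have hM₁ : K' ≤ M₀ := by rw [hM₀]; nlinarith [mul_nonneg hκ0 hK'0]
  have hM₂ : κ * K' ≤ M₀ := by rw [hM₀]; nlinarith [mul_nonneg hκ0 hK'0]
  have hM₃ : 3 * 1 * κ * K' + 2 * κ * K' ^ 2 ≤ M₀ := by rw [hM₀]; nlinarith [mul_nonneg hκ0 hK'0]
  -- the bounds on `D_xⁿU`, `n ≤ 3`, at the points of `Ω`
  have hbd' : ∀ n ≤ 3, ∀ w ∈ Ioo (-1 : ℝ) 0 ×ˢ (closedBall (0 : EuclideanSpace ℝ (Fin 3)) R)ᶜ,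
      ‖iteratedFDeriv ℝ n (U w.1) w.2‖ ≤ K' := fun n hn w hw => (hbdK n hn w hw).trans hKK'
  have hpt : ∀ t ∈ Ioo (-1 : ℝ) 0, ∀ x ∈ (closedBall (0 : EuclideanSpace ℝ (Fin 3)) R)ᶜ,
      ‖U t x‖ ≤ K' ∧ ‖fderiv ℝ (U t) x‖ ≤ K' ∧
      ‖curl (U t) x‖ ≤ κ * K' ∧ ‖fderiv ℝ (curl (U t)) x‖ ≤ κ * K' ∧
      ‖iteratedFDeriv ℝ 2 (curl (U t)) x‖ ≤ κ * K' ∧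
      ‖(1 : ℝ) • Δ (curl (U t)) x - convect (U t) (curl (U t)) x + convect (curl (U t)) (U t) x‖ ≤
        3 * 1 * κ * K' + 2 * κ * K' ^ 2 := by
    intro t ht x hx
    have h0 : ‖U t x‖ ≤ K' := by
      rw [← norm_iteratedFDeriv_zero (𝕜 := ℝ)]; exact hbd' 0 (by norm_num) (t, x) ⟨ht, hx⟩
    have h1 : ‖fderiv ℝ (U t) x‖ ≤ K' := by
      rw [satFR_norm_fderiv_eq_norm_iteratedFDeriv_one]; exact hbd' 1 (by norm_num) (t, x) ⟨ht, hx⟩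
    exact ⟨h0, h1, vorticity_pointwise_bounds hS (hU3 t ht) hx hK'0 zero_le_one h0 h1
      (hbd' 2 (by norm_num) (t, x) ⟨ht, hx⟩) (hbd' 3 le_rfl (t, x) ⟨ht, hx⟩)⟩
  refine ⟨R, M₀, U, hR₀R, hae, hUc, hU3, fun t ht x hx => ?_, hC1, fun t ht x hx => ?_, hEq⟩
  · obtain ⟨h0, h1, -⟩ := hpt t ht x hx
    exact ⟨h0.trans hM₁, h1.trans hM₁⟩
  · obtain ⟨-, -, b0, b1, b2, bt⟩ := hpt t ht x hx
    refine ⟨b0.trans hM₂, b1.trans hM₂, b2.trans hM₂, ?_⟩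
    rw [hEq t ht x hx]
    exact bt.trans hM₃

end Summit.NavierStokesRegularity.NavierStokesRegularity.Theorems

end
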